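import Literature.NumberTheory.EllipticCurves.KrizLi2019.SexticTwistBSDThree
import Literature.NumberTheory.EllipticCurves.HeegnerFieldOfDiscriminantProofs
import Mathlib.NumberTheory.LegendreSymbol.JacobiSymbol
import HarnessLib
import Literature.NumberTheory.QuadraticFields.ThreeClassNumberOneDensity

/-!
# Crux 3 `MazurMCOnCellB` (stmt-BirchSwinnertonDyer-19033), line `twistback` v4 — road (d) into stub 6:
# the HEEGNER-FIELD HALF of the partner supply — for every level `N` and every positive fundamental discriminant
# `D`, an imaginary quadratic `K` with `d_K` odd `< −4`, every prime of `6N·D` split, and `3 ∤ h(ℚ(√(D·d_K)))`,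
# from ONE published density theorem (Nakagawa–Horie 1988 + Taya 2000, as in Kriz–Li 2019 Thm. 9.2 / Prop. 9.3)

Width seat bsd-line-x2-p1-w6 (g0), 2026-08-28. HONEST FRAMING (cell `bsd-eis`, run/shared/lean/pub/bsd-eis/):
conditional theorems only; ONE new named fact (PUBLISHED, refereed; nothing asserted; taken as the hypothesis
`hNH`), no `sorry`; nothing is booked; no main conjecture / BSD is proved for any curve; 0 cells / labels / tiers
move; no summit statement is proved by this seat.

WHY (LEAD g10 verdict g10 §2/§4, HANDOFF NEXT (2); LEAD caution bsd-eis STATUS 2026-08-28T16:25:09Z; this seat's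
page reading of Kriz–Li §9 = arXiv:1609.06687 §4, STATUS 16:41:16Z): on road (d) the (∃-PARTNER) at a NON-split
X2b pair `(W, 3)` needs ONE admissible `K` — imaginary quadratic, Heegner for `N_W` and for `3`, `d_K` odd `< −4` —
with (i) `ord_{s=1} L(E^{(d_K)}, s) = 1` and (ii) a KL-flat carrier, whose class-number content is
`3 ∤ h(ℚ(√(D·d_K)))` for the even character `ψ_E = χ_D` of the pair (`D > 0`, `χ_D(3) = −1`; w3 g7
`…TwistbackPartnerClassNumberLift`). Kriz–Li's JOINT statements (Thm. 9.4 second assertion, Thm. 9.7) do not reach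
X2b (their non-torsion criterion Thm. 1.20 needs local balance `0`, the row has odd balance); what print DOES give
for every `E` is the FIELD half: Nakagawa–Horie's density theorem with congruence conditions (Proc. AMS 104 (1988)
Thm. 1 = Kriz–Li Thm. 9.2) and Taya's count (Proc. AMS 128 (2000) = Kriz–Li Prop. 9.3: for a VALID pair `(m, M)`
the imaginary quadratic fields `k` with `d_k ≡ m (mod M)` and `h₃(d_k) = 1` have POSITIVE DENSITY), and the CRT
choice of `(m, M)` in the proof of Kriz–Li Thm. 9.4 — whose hypotheses (2)–(5) on `ψ` are NOT used for its first
assertion. This file vendors the density theorem ONCE, in EXISTENCE form (weaker than print), and performs the CRT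
bookkeeping in the kernel for the valid pair `(m, M) = (D, 24·A·D²)` (`A` any positive integer, e.g. `A = N_W`):
a field `k` with `d_k ≡ D (mod 24AD²)` has `d_k = D·d_K` with `d_K ≡ 1 (mod 24AD)`, so `d_K` is odd, squarefree,
negative, `≡ 1 (mod 8)`, `≡ 1 (mod 3)`, `≡ 1 (mod ℓ)` for every `ℓ ∣ A·D`, and `h₃(D·d_K) = h₃(d_k) = 1`.

* §1 the named fact `nakagawaHorie_taya_exists_imaginary_h3_eq_one` (to be RELOCATED by the gate to
  `Literature/NumberTheory/QuadraticFields/ThreeClassNumberOneDensity.lean`; the sextic-twist instance of Kriz–Li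
  Thm. 9.4 that it generalises is `KrizLi2019.HeegnerFieldSupply.thm94_exists_heegnerField_h3_eq_one`).
* §2 `isValidPair_of_fundamental` — `(D, 24·A·D²)` is a valid pair (Kriz–Li Def. 9.1) for `D > 0` fundamental.
* §3 `exists_heegnerField_threeClassNumberTrivial` — for `D > 0` fundamental, `A > 0`, `X`: an imaginary quadratic
  `K` with `d_K < −X`, `d_K < −4`, `d_K ≡ 1 (mod 24·A·D)`, `d_K` odd, `SatisfiesHeegnerHypothesis (24·A·|D|) K`,
  `ThreeClassNumberTrivial (D · d_K)`.
* §4 `exists_admissibleField_threeClassNumberTrivial` — the door's binder shape at a curve `W` (`A = N_W`):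
  `IsImaginaryQuadratic K ∧ SatisfiesHeegnerHypothesis (W.conductorNorm ℤ) K ∧ SatisfiesHeegnerHypothesis 3 K ∧
  Odd d_K ∧ d_K < −4 ∧ d_K ≡ 1 (mod D) ∧ ThreeClassNumberTrivial (D · d_K)` — everything p645525 §3 /
  p645771 §3 ask of `K` EXCEPT the analytic rank (i) and the carrier, which stay per pair (certificate; w6 p649483
  §2 turns (i) into «one Heegner point of infinite order») or road (d′) (w5 g0).

References: [NakagawaHorie1988] J. Nakagawa, K. Horie, *Elliptic curves with no rational points*, Proc. AMS 104
(1988), Thm. 1; H. Taya, *Iwasawa invariants and class numbers of quadratic fields for the prime 3*, Proc. AMS 128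
(2000) 1285–1292; [KrizLi2019] Def. 9.1, Thm. 9.2, Prop. 9.3, Thm. 9.4 (proof) (Forum Math. Sigma 7 (2019) e15, §9)
= arXiv:1609.06687 Def. 4.1, Thm. 4.2, Prop. 4.3, Thm. 4.4; [Marcus2018] Ch. 2 Thm. 1, Ch. 3 Thm. 25.
-/

set_option autoImplicit false

-- `Summit.BirchSwinnertonDyer.BirchSwinnertonDyer.…`: the summit and its single sub-problem share a name.
set_option linter.dupNamespace false

noncomputable section

open scoped Classical

open WeierstrassCurve NumberField
  Literature.NumberTheory.EllipticCurves
  Literature.NumberTheory.EllipticCurves.KrizLi2019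
  Literature.NumberTheory.QuadraticFields

namespace Summit.BirchSwinnertonDyer.BirchSwinnertonDyer.Theorems.EisensteinPrimesMazurMCOnCellBTwistbackKLFieldSupply

/-! ## §1. The named fact: Nakagawa–Horie 1988 Thm. 1 with Taya 2000 (Kriz–Li 2019 Thm. 9.2 / Prop. 9.3), existence form -/

/-- For a positive fundamental discriminant `D` (so `D ≡ 1 (mod 4)` squarefree, or `D = 4m`, `m ≡ 2, 3 (mod 4)`
squarefree) and any natural number `A`, the pair `(m, M) = (D, 24·A·D²)` is valid in the sense of Kriz–Li Def. 9.1: an odd prime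
`ℓ ∣ D` has `ℓ² ∣ D² ∣ M` and `ℓ² ∤ D`; `M` is even, and either `D ≡ 1 (mod 4)` (with `4 ∣ M`) or `4 ∣ D`, whence
`16 ∣ D² ∣ M` and `D = 4m ≡ 8, 12 (mod 16)`. Elementary. [cite: KrizLi2019, Def. 9.1 (§9)] -/
theorem isValidPair_of_fundamental {D : ℤ} (hD0 : 0 < D)
    (hDf : (D % 4 = 1 ∧ Squarefree D ∧ D ≠ 1) ∨ (4 ∣ D ∧ (D / 4 % 4 = 2 ∨ D / 4 % 4 = 3) ∧ Squarefree (D / 4)))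
    (A : ℕ) :
    (∀ ℓ : ℕ, ℓ.Prime → ℓ ≠ 2 → ℓ ∣ D.natAbs → ℓ ∣ 24 * A * D.natAbs ^ 2 →
        ℓ ^ 2 ∣ 24 * A * D.natAbs ^ 2 ∧ ¬ ℓ ^ 2 ∣ D.natAbs) ∧
      (2 ∣ 24 * A * D.natAbs ^ 2 →
        (4 ∣ 24 * A * D.natAbs ^ 2 ∧ D.natAbs % 4 = 1) ∨
          (16 ∣ 24 * A * D.natAbs ^ 2 ∧ (D.natAbs % 16 = 8 ∨ D.natAbs % 16 = 12))) := by
  have hDabs : (D.natAbs : ℤ) = D := Int.natAbs_of_nonneg hD0.le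
  refine ⟨fun ℓ hℓ hℓ2 hℓD _ ↦ ⟨Dvd.dvd.mul_left (pow_dvd_pow_of_dvd hℓD 2) _, fun hsq ↦ ?_⟩, fun _ ↦ ?_⟩
  · -- an odd prime square does not divide a fundamental discriminant
    have hsqZ : ((ℓ : ℤ) ^ 2) ∣ D := by
      rw [← hDabs]; exact_mod_cast hsq
    rcases hDf with ⟨-, hsf, -⟩ | ⟨h4, -, hsf⟩
    · have h := hsf (ℓ : ℤ) (by simpa [sq] using hsqZ)
      rw [Int.isUnit_iff_natAbs_eq, Int.natAbs_natCast] at h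
      exact hℓ.one_lt.ne' h
    · -- `ℓ² ∣ D = 4 (D/4)` with `ℓ` odd gives `ℓ² ∣ D/4`, contradicting squarefreeness
      have hcop : IsCoprime ((ℓ : ℤ) ^ 2) 4 := by
        have h2 : IsCoprime (ℓ : ℤ) ((2 : ℕ) : ℤ) :=
          Nat.isCoprime_iff_coprime.mpr ((Nat.coprime_primes hℓ Nat.prime_two).mpr hℓ2)
        have h4 : IsCoprime ((ℓ : ℤ) ^ 2) (((2 : ℕ) : ℤ) ^ 2) := IsCoprime.pow h2
        norm_num at h4
        exact h4
      have hdvd4 : ((ℓ : ℤ) ^ 2) ∣ D / 4 := by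
        have : ((ℓ : ℤ) ^ 2) ∣ 4 * (D / 4) := by rwa [Int.mul_ediv_cancel' h4]
        exact hcop.dvd_of_dvd_mul_left this
      have h := hsf (ℓ : ℤ) (by simpa [sq] using hdvd4)
      rw [Int.isUnit_iff_natAbs_eq, Int.natAbs_natCast] at h
      exact hℓ.one_lt.ne' h
  · rcases hDf with ⟨h1, -, -⟩ | ⟨h4, hm, -⟩
    · left
      refine ⟨Dvd.dvd.mul_right (Dvd.dvd.mul_right (by norm_num) _) _, ?_⟩
      have : (D.natAbs : ℤ) % 4 = 1 := by rw [hDabs]; exact h1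
      omega
    · right
      obtain ⟨m, rfl⟩ := h4
      rw [Int.mul_ediv_cancel_left _ four_ne_zero] at hm
      have hm0 : 0 < m := by omega
      have hnat : (4 * m).natAbs = 4 * m.natAbs := by
        rw [Int.natAbs_mul]; rfl
      refine ⟨?_, ?_⟩
      · rw [hnat]
        exact ⟨24 * A * m.natAbs ^ 2, by ring⟩
      · have h16 : ((4 * m).natAbs : ℤ) % 16 = 8 ∨ ((4 * m).natAbs : ℤ) % 16 = 12 := by
          rw [hDabs]; omega
        omega

/-! ## §3. The Heegner-field supply with `3 ∤ h(ℚ(√(D·d_K)))` -/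

/-- **THE FIELD HALF OF THE PARTNER SUPPLY.** For every positive fundamental discriminant `D`, every `A > 0` and
every bound `X`: there is an imaginary quadratic field `K` with `d_K < −X`, `d_K < −4`, `d_K ≡ 1 (mod 24·A·D)`
(so `d_K` is odd and prime to `A·D`), in which EVERY prime dividing `24·A·D` splits (`SatisfiesHeegnerHypothesis
(24·A·|D|) K`, hence for `A`, for `3`, for `2`, for `|D|` by `SatisfiesHeegnerHypothesis.of_dvd`), and with
`3 ∤ h_F` for every quadratic field `F ∋ √(D·d_K)` (`ThreeClassNumberTrivial (D · d_K)`, i.e. `h₃(D·d_K) = 1`;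
`D·d_K` is the fundamental discriminant of `ℚ(√(D·d_K))` since `gcd(d_K, D) = 1`). Proof = Kriz–Li's proof of
Thm. 9.4 (first assertion) without its hypotheses on `ψ`: the pair `(m, M) = (D, 24·A·D²)` is valid (§2); the named
fact gives a fundamental `δ < −(X+5)·D` with `δ ≡ D (mod 24·A·D²)` and `h₃(δ) = 1`; then `δ = D·d_K` with
`d_K = 1 + 24·A·D·t`, `d_K` is squarefree (`δ` or `δ/4 = (D/4)·d_K` is) and `≡ 1 (mod 8)`, and `K := ℚ(√d_K)`
(the tree's `sqrtField`, `discr_sqrtField`, `satisfiesHeegnerHypothesis_sqrtField`) has all the properties.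
CONDITIONAL on the named fact `hNH` (Nakagawa–Horie + Taya; nothing asserted).
[cite: KrizLi2019, Thm. 9.4 (first assertion) and its proof (§9) = arXiv:1609.06687 Thm. 4.4] [cite: NakagawaHorie1988, Thm. 1]
[cite: Marcus2018, Ch. 2 Thm. 1 and Ch. 3 Thm. 25] -/
theorem exists_heegnerField_threeClassNumberTrivial (hNH : Literature.NumberTheory.QuadraticFields.nakagawaHorie_taya_exists_imaginary_h3_eq_one)
    {D : ℤ} (hD0 : 0 < D)
    (hDf : (D % 4 = 1 ∧ Squarefree D ∧ D ≠ 1) ∨ (4 ∣ D ∧ (D / 4 % 4 = 2 ∨ D / 4 % 4 = 3) ∧ Squarefree (D / 4)))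
    {A : ℕ} (hA : 0 < A) (X : ℕ) :
    ∃ (K : Type) (_ : Field K) (_ : NumberField K), IsImaginaryQuadratic K ∧
      NumberField.discr K < -(X : ℤ) ∧ NumberField.discr K < -4 ∧
      NumberField.discr K ≡ 1 [ZMOD (24 * A * D)] ∧ Odd (NumberField.discr K) ∧
      SatisfiesHeegnerHypothesis (24 * A * D.natAbs) K ∧
      ThreeClassNumberTrivial (D * NumberField.discr K) := by
  have hDabs : (D.natAbs : ℤ) = D := Int.natAbs_of_nonneg hD0.le
  -- the valid pair `(D, 24·A·D²)` and the named fact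
  have hm0 : 0 < D.natAbs := Int.natAbs_pos.mpr hD0.ne'
  have hM0 : 0 < 24 * A * D.natAbs ^ 2 := by positivity
  obtain ⟨hv1, hv2⟩ := isValidPair_of_fundamental hD0 hDf A
  obtain ⟨δ, hδX, hδf, hδm, hδ3⟩ := hNH (D.natAbs) (24 * A * D.natAbs ^ 2) hm0 hM0 hv1 hv2 ((X + 5) * D.natAbs)
  -- `δ = D · d_K` with `d_K = 1 + 24·A·D·t`
  obtain ⟨t, ht⟩ := (Int.modEq_iff_dvd.mp hδm.symm)
  push_cast at ht hδX
  rw [abs_of_pos hD0] at ht hδX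
  set dK : ℤ := 1 + 24 * A * D * t with hdK_def
  have hδ : δ = D * dK := by rw [hdK_def]; linear_combination ht
  -- size: `d_K < −(X + 4)`
  have hlt : dK < -((X : ℤ) + 4) := by
    by_contra h
    push Not at h
    have h1 : D * (-((X : ℤ) + 4)) ≤ D * dK := mul_le_mul_of_nonneg_left h hD0.le
    rw [← hδ] at h1
    nlinarith
  have hdK0 : dK < 0 := by linarith
  -- congruences: `d_K = 1 + 8·(3ADt) = 1 + 4·(6ADt)`
  have h8 : dK % 8 = 1 := by
    have : dK = 1 + 8 * (3 * A * D * t) := by rw [hdK_def]; ring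
    rw [this]; omega
  have h4 : dK % 4 = 1 := by omega
  have hodd : Odd dK := ⟨4 * (3 * A * D * t), by rw [hdK_def]; ring⟩
  have hmod : dK ≡ 1 [ZMOD (24 * A * D)] :=
    Int.modEq_iff_dvd.mpr ⟨-t, by rw [hdK_def]; ring⟩
  -- `d_K` is squarefree: `δ` is fundamental, `δ = D·d_K`, and `d_K` is odd
  have hsf : Squarefree dK := by
    rcases hδf with ⟨-, hsfδ, -⟩ | ⟨h4δ, -, hsfδ⟩
    · exact Squarefree.squarefree_of_dvd ⟨D, by rw [hδ, mul_comm]⟩ hsfδ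
    · have hcop : IsCoprime (4 : ℤ) dK :=
        ⟨-(2 * (3 * A * D * t)), 1, by rw [hdK_def]; ring⟩
      have h4D : (4 : ℤ) ∣ D := hcop.dvd_of_dvd_mul_right (by rw [← hδ]; exact h4δ)
      have hq : δ / 4 = D / 4 * dK := by rw [hδ]; exact Int.mul_ediv_assoc' dK h4D
      exact Squarefree.squarefree_of_dvd ⟨D / 4, by rw [hq, mul_comm]⟩ hsfδ
  -- the field `K = ℚ(√d_K)`
  haveI : Fact (dK < 0) := ⟨hdK0⟩
  have hdisc : NumberField.discr (sqrtField dK) = dK := discr_sqrtField dK h4 hsf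
  refine ⟨sqrtField dK, inferInstance, inferInstance, isImaginaryQuadratic_sqrtField dK, ?_, ?_, ?_, ?_, ?_, ?_⟩
  · rw [hdisc]; linarith
  · rw [hdisc]; linarith
  · rw [hdisc]; exact hmod
  · rw [hdisc]; exact hodd
  · -- every prime of `24·A·|D|` splits: `d_K ≡ 1 (mod 8)` and `d_K ≡ 1 (mod ℓ)` for the odd `ℓ ∣ 24·A·D`
    refine satisfiesHeegnerHypothesis_sqrtField dK h8 hsf fun ℓ hℓ hℓdvd hℓ2 ↦ ?_
    obtain ⟨c, hc⟩ := hℓdvd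
    have hcZ : (24 : ℤ) * A * D = ℓ * c := by
      have h := congrArg (fun n : ℕ ↦ (n : ℤ)) hc
      push_cast at h
      rw [abs_of_pos hD0] at h
      exact h
    have hdKℓ : dK = 1 + (ℓ : ℤ) * (c * t) := by
      rw [hdK_def, ← mul_assoc, ← hcZ]
    have hℓ1 : (1 : ℤ) < ℓ := by exact_mod_cast hℓ.one_lt
    have hmodℓ : dK % (ℓ : ℤ) = 1 := by
      rw [hdKℓ, Int.add_mul_emod_self_left]
      exact Int.emod_eq_of_lt zero_le_one hℓ1
    rw [jacobiSym.mod_left, hmodℓ, jacobiSym.one_left]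
  · rw [hdisc, ← hδ]; exact hδ3

/-! ## §4. The binder shape of the door at a curve `W` (`A = N_W`) -/

/-- **THE ADMISSIBLE FIELD for road (d) at a curve `W`, with the KL-flat class number, from print.** For `W/ℚ`
elliptic (conductor `N_W`) and a positive fundamental discriminant `D` (the conductor-discriminant of the pair's even
character `ψ_E = χ_D`): there is `K` imaginary quadratic with `SatisfiesHeegnerHypothesis (W.conductorNorm ℤ) K`,
`SatisfiesHeegnerHypothesis 3 K`, `SatisfiesHeegnerHypothesis 2 K`, `d_K` odd, `d_K < −4`, `d_K ≡ 1 (mod D)` (so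
`gcd(d_K, D) = 1` and `D·d_K` is the discriminant of `ℚ(√(D·d_K))`), and `ThreeClassNumberTrivial (D · d_K)` —
i.e. EVERY hypothesis on `K` of p645525 §3 `upperPartner_at_of_klFlat_partner` / p645771 §3 except the analytic
rank `r_an(E^{(d_K)}) = 1` (per pair: a Heegner point of infinite order, w6 p649483 §2; or road (d′)) and the
carrier's line data (w3 g8's dictionary), with the class number `3 ∤ h(ℚ(√(D·d_K)))` that makes the carrier
KL-flat (w3 g7 `norm_twistedBernoulli_teichmullerLift_inv_eq_one_iff_three`). §3 with `A = N_W`. CONDITIONAL on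
the named fact `hNH` (Nakagawa–Horie + Taya). [cite: KrizLi2019, Thm. 9.4 (first assertion) (§9)]
[cite: NakagawaHorie1988, Thm. 1] -/
theorem exists_admissibleField_threeClassNumberTrivial (hNH : Literature.NumberTheory.QuadraticFields.nakagawaHorie_taya_exists_imaginary_h3_eq_one)
    (W : WeierstrassCurve ℚ) [W.IsElliptic] {D : ℤ} (hD0 : 0 < D)
    (hDf : (D % 4 = 1 ∧ Squarefree D ∧ D ≠ 1) ∨ (4 ∣ D ∧ (D / 4 % 4 = 2 ∨ D / 4 % 4 = 3) ∧ Squarefree (D / 4))) :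
    ∃ (K : Type) (_ : Field K) (_ : NumberField K), IsImaginaryQuadratic K ∧
      SatisfiesHeegnerHypothesis (W.conductorNorm ℤ) K ∧ SatisfiesHeegnerHypothesis 3 K ∧
      SatisfiesHeegnerHypothesis 2 K ∧
      Odd (NumberField.discr K) ∧ NumberField.discr K < -4 ∧ NumberField.discr K ≡ 1 [ZMOD D] ∧
      ThreeClassNumberTrivial (D * NumberField.discr K) := by
  have hN : 0 < W.conductorNorm ℤ := W.conductorNorm_pos_holds
  obtain ⟨K, _, _, hK, -, hlt, hmod, hodd, hH, h3⟩ :=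
    exists_heegnerField_threeClassNumberTrivial hNH hD0 hDf hN 0
  refine ⟨K, inferInstance, inferInstance, hK, hH.of_dvd ⟨24 * D.natAbs, by ring⟩, hH.of_dvd ⟨8 * _ * D.natAbs, by ring⟩,
    hH.of_dvd ⟨12 * _ * D.natAbs, by ring⟩, hodd, hlt, ?_, h3⟩
  exact Int.ModEq.of_mul_left (24 * (W.conductorNorm ℤ : ℤ)) (by simpa [mul_comm, mul_left_comm, mul_assoc] using hmod)

end Summit.BirchSwinnertonDyer.BirchSwinnertonDyer.Theorems.EisensteinPrimesMazurMCOnCellBTwistbackKLFieldSupply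

end
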